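import Summits.BirchSwinnertonDyer.Rank1Residual.Additive.ShaCardSignedTwistRankOneOfReading
import Summits.BirchSwinnertonDyer.Rank1Residual.Additive.QuadraticBranchOddStrictExactControl
import Summits.BirchSwinnertonDyer.Rank1Residual.Additive.QuadraticBranchOddStrictSelmerLevel
import Summits.BirchSwinnertonDyer.Rank1Residual.Additive.TypeGIntegralJ
import Summits.BirchSwinnertonDyer.Rank1Residual.Additive.GordCycLowerBoundOfControlTamagawaSharp
import Summits.BirchSwinnertonDyer.Rank1Residual.EisensteinPrimes
import Literature.NumberTheory.EllipticCurves.CyclotomicZpExtension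
import Literature.NumberTheory.EllipticCurves.LeadingTermBSZOrdinaryProofs
import Literature.NumberTheory.EllipticCurves.PastenValuationProductThm115Proofs
import Literature.NumberTheory.EllipticCurves.TamagawaNeZeroProofs
import Literature.NumberTheory.EllipticCurves.TamagawaRingEquivProofs
import Literature.NumberTheory.EllipticCurves.TamagawaSubgroupProofs
import Literature.NumberTheory.EllipticCurves.PadicFormalLogOrder
import HarnessLib

/-!
# (C3_η) DISCHARGED MODULO PRINT-SHAPED HYPOTHESES: the cell's typed MISSING INPUT
# `QuadraticBranchOddStrictExactControlOfPlusMCAt W p` (exact bottom-layer control on the odd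
# `η`-branch, given (C1_η)) is a THEOREM given `hPT` (Poitou–Tate for finite Selmer structures, named
# fact), the Kitajima–Otsuki reading (R2) / its verbatim shape, and the EXACT reading of Kobayashi's
# Thm. 7.4 at `η` ((C1_η) ⟹ `Char X^{−,str}(W/ℚ_∞) = (X⁻¹L_p⁻(V, η, X))`), plus GZK
# (cell `b2b-bsdres`, CLASS-CLOSURE lane, class O10 — x1b GEN 44, class lead; file 123 of the series)

HONEST FRAMING (cell `b2b-bsdres`, run/shared/lean/b2b/bsd-rank1-residual/, verbatim in every
file): the goal of the cell is to DELETE the COMBINATION-SHAPED residual classes of the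
Birch–Swinnerton-Dyer formula for ALL analytic-rank `≤ 1` elliptic curves over `ℚ` — "full BSD
formula for every rank `≤ 1` curve in class `C`" assembled STRICTLY from published theorems — so
that the rank-`≤ 1` remainder becomes exactly the CONSTRUCTION-SHAPED classes, which are TYPED
(missing-input `Prop`s), NOT attempted. This is not "finishing BSD". CLASS-CLOSURE lane: prove
what is provable now; shrink each hard class to its core with data; no claim beyond stated classes;
research routes on CONSTRUCTION-SHAPED X12 / O10; census / instrument output = EVIDENCE / conjecture
items, NEVER a Literature fact; `RESIDUAL-MAP.md` marks change only by signed lines. THIS FILE: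
TOOL THEOREMS ONLY — no definition, no named Literature fact, no Summits-side fact `def … : Prop`,
no `sorry`, axioms standard. Its theorems are CONDITIONAL on exactly the displayed hypotheses:
`hPT : poitouTate_selmerStructure_duality_real ℚ` (named fact, Milne I 4.10 / Howard 2.1.11);
`hGZK : rank_eq_analyticRank_of_analyticRank_le_one` (named fact, Gross–Zagier–Kolyvagin);
`hR2 : OddBranchStrictMinusNoFiniteSubmoduleAt W p` (the cell's TYPED READING of Kitajima–Otsuki 2018
Main Thm. 1.3, sign `−` — or its verbatim shape `hKO`); and `h74x`, the EXACT reading of Kobayashi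
2003 Thm. 7.4 at `η` on the strict-minus dual datum ("(C1_η) ⟹ `Char X⁻(V/K_∞)^η =
(X⁻¹L_p⁻(V, η, X))`", the ideal EQUALITY the source's equivalence gives; the cell's (R3)
`OddBranchStrictMinusDivisibilityOfPlusMCAt` records only the divisibility half `g ∣ X⁻¹L`) — a
HYPOTHESIS TEXT, nothing asserted. (C1_η) itself sits INSIDE the discharged statement as its own
hypothesis and is untouched: a CONJECTURE IN PRINT. Nothing is booked; no label / mark / count /
sub-cell moves; nothing about (C1_η), (C2_η-GZ) or `BSD(W, p)` of any pair is claimed; the classes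
served stay OPEN.

## What

`QuadraticBranchOddStrictExactControlOfPlusMCAt W p` (cc-typer-6, p307042 §2): for `W/ℚ` globally
minimal of analytic rank one, `p ≥ 5`, the good `a_p = 0` twin `V` (`C • W^{(p*)} = V`) with (C1_η),
newform `f`, period ratio `ϖ`, any `L` with `IsQuadraticBranchMinusLFunction f p ϖ L`, `W(ℚ_p)` with
no point of order `p`, a generator `P` modulo torsion of `p`-divisibility level `n`, `coeff₁ L ≠ 0`:
`Sel_str(W/ℚ)[p^∞]` finite and `ord_p #Sel_str + n + ord_p(Tam(W)/#W(ℚ)_tors²) = v_p(coeff₁ L)`.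

PROOF (`quadraticBranchOddStrictExactControlOfPlusMCAt_of_readings`): GZK gives `Ш(W)` finite; the
cyclotomic `ℤ_p`-extension `κ_cyc` of `ℚ` with a normalised topological generator `γ`
(`χ_p(γ) = 1 + p`, tree `CyclotomicZp`) and a strict-minus dual datum `D` exist; `h74x` gives
`char(X) = (L')` with `L = X·L'`, `L'(0) = coeff₁ L`; file 122 (x1b GEN 44: the Selmer side from
`hPT` + (R2) + `Ш` finite + the generator) gives `#Ш[p^∞]·p^{2n}·∏_{ℓ∈T} p^{ord_p c_ℓ} = p^{ord_p L'(0)}`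
for `T` = the bad places `≠ p`; gen 30's index `#Sel_str = p^n·#Ш[p^∞]`; and the bookkeeping
`∑_{ℓ∈T} ord_p c_ℓ(W) = ord_p Tam(W)` (`c_p(W) ≤ 4 < p`: `W` is not multiplicative at `p` since its
twin is good there — `j` is `p`-integral, Delbourgo's (G); Kodaira–Néron), `p ∤ #W(ℚ)_tors`
(`W(ℚ_p)[p] = 0`).  NET: on the pair, (C3_η) is no longer an independent typed input — what carries
it is `hPT` + (R2)/`hKO` + the exact Thm. 7.4 reading + GZK; the O10-PS residue is (C1_η) ∧ (C2_η-GZ).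

References: [Kobayashi2003] §2 p. 4, Def. 2.1, Thm. 2.2 (p. 5), §4 + Thm. 4.1 (p. 8), Thm. 7.4 (p. 13),
Lemma 9.1 (p. 25), Thm. 9.3 (p. 26); [KitajimaOtsuki2018] Main Thm. 1.3; [GreenbergLNM1716] §3–§4;
[MilneADT2006] I Thm. 4.10; [SilvermanAEC2009] VII.5 Prop. 5.1, VII.6 (Kodaira–Néron), VII.6.3;
[Gross1991] Thm. 1.3; [Miller2011LMS] §1.
-/

noncomputable section

open scoped Classical MatrixGroups ModularForm

open CongruenceSubgroup Field Function NumberField IsDedekindDomain WeierstrassCurve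
open Literature.NumberTheory.EllipticCurves
open Literature.NumberTheory.EllipticCurves.ModularForms
open Literature.NumberTheory.EllipticCurves.Kobayashi2003
open Literature.NumberTheory.EllipticCurves.Rank1Residual
open Literature.NumberTheory.EllipticCurves.Rank1Residual.Typed
open Literature.NumberTheory.GaloisRepresentations
open Literature.NumberTheory.GaloisCohomology
open Literature.NumberTheory.EllipticCurves.IwasawaAlgebra

-- Over `ℚ` two `ℚ`-algebra structures on a completion are in scope; the general-`K` statements must be
-- met by the completion's own (the device of files 78, 107, 108, 118, 120–122).
attribute [local instance 10000] IsDedekindDomain.HeightOneSpectrum.instAlgebraAdicCompletion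
  NumberField.Place.instAlgebraCompletion

namespace Summit.BirchSwinnertonDyer.Rank1Residual.Additive.LevelBridge

variable (W : WeierstrassCurve ℚ) [W.IsElliptic] [W.IsGloballyMinimal] (p : ℕ) [hp : Fact p.Prime]

/-! ## §0 Bookkeeping: `ord_p c_p(W) = 0`, `∑_{ℓ∈T} ord_p c_ℓ = ord_p Tam(W)`, `p ∤ #W(ℚ)_tors` -/

omit [W.IsGloballyMinimal] in
/-- **`ord_p c_p(W) = 0` for the `p*`-twist `W` of a curve `V` with good reduction
at `p ≥ 5`.**  The twin being good at `p`, `W` has Delbourgo's type (G) (tree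
`typeG_of_hasGoodReductionAtPrime_quadraticTwist`), so `ord_p j(W) ≥ 0` and `W` is NOT multiplicative
at `p` (`ord_p j < 0` there); by Kodaira–Néron `c_p(W) ≤ 4 < p` off split multiplicative reduction.
[cite: SilvermanAEC2009, VII.5 Prop. 5.1 and Thm. VII.6.1 (Kodaira–Néron)] -/
theorem padicValNat_localTamagawaNumber_eq_zero_of_quadraticTwist_signedPrime (hp5 : 5 ≤ p)
    (Cv : VariableChange ℚ) (V : WeierstrassCurve ℚ) [V.IsElliptic] [V.IsGloballyMinimal]
    (hCV : Cv • W.quadraticTwist ((-1) ^ (p / 2) * p) = V) (hgood : V.HasGoodReductionAtPrime p) :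
    padicValNat p ((W.baseChange (((Rat.HeightOneSpectrum.primesEquiv (R := 𝓞 ℚ)).symm ⟨p, hp.out⟩).adicCompletion ℚ)).localTamagawaNumber
      (((Rat.HeightOneSpectrum.primesEquiv (R := 𝓞 ℚ)).symm ⟨p, hp.out⟩).adicCompletionIntegers ℚ)) = 0 := by
  have hp2 : p ≠ 2 := by omega
  have htw : (W.quadraticTwist ((-1 : ℚ) ^ (p / 2) * p)).HasGoodReductionAtPrime p := by
    rw [← hCV] at hgood
    exact (BSZLemma17.hasGoodReductionAtPrime_smul_iff _ Cv p).mp hgood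
  have hG : TypeG W p := typeG_of_hasGoodReductionAtPrime_quadraticTwist W p hp2 htw
  have hj : 0 ≤ padicValRat p W.j := padicValRat_j_nonneg_of_typeG W p hG
  have hnm : ¬ Mult W p := fun hm ↦
    absurd hj (not_le.mpr (EisensteinPrimes.padicValRat_j_neg_of_mult W p hm))
  have hns : ¬ ((W.baseChange ℚ_[p]).minimal ℤ_[p]).HasSplitMultiplicativeReduction ℤ_[p] :=
    fun hs ↦ hnm hs.toHasMultiplicativeReduction
  have h4 := localTamagawaNumber_padic_le_four p (W.baseChange ℚ_[p]) hns
  have h0 := localTamagawaNumber_padic_ne_zero_holds p (W.baseChange ℚ_[p])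
  rw [← localTamagawaNumber_padic_eq_holds W _ p (by rw [Equiv.apply_symm_apply])]
  refine padicValNat.eq_zero_of_not_dvd fun h ↦ ?_
  have := Nat.le_of_dvd (Nat.pos_of_ne_zero h0) h
  omega

/-- `ord_p` of a finite product of non-zero naturals is the sum of the `ord_p`. [folklore] -/
theorem padicValNat_finset_prod' {ι : Type*} (s : Finset ι) (g : ι → ℕ)
    (hg : ∀ i ∈ s, g i ≠ 0) : padicValNat p (∏ i ∈ s, g i) = ∑ i ∈ s, padicValNat p (g i) := by
  induction s using Finset.cons_induction with
  | empty => simp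
  | cons a s ha ih =>
    rw [Finset.prod_cons, Finset.sum_cons,
      padicValNat.mul (hg a (Finset.mem_cons_self a s))
        (Finset.prod_ne_zero_iff.mpr fun i hi ↦ hg i (Finset.mem_cons_of_mem hi)),
      ih fun i hi ↦ hg i (Finset.mem_cons_of_mem hi)]

omit [W.IsGloballyMinimal] in
/-- **`∑_{ℓ ∈ T} ord_p c_ℓ(W) = ord_p Tam(W)`** for any finite `T ∌ (p)` containing every `ℓ ≠ p` with
`p ∣ c_ℓ(W)`, when `p ∤ c_p(W)`: `Tam(W) = ∏_{v ∈ S'} c_v` over any finite `S'` containing the bad places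
(`c_v = 1` at good `v`, tree `localTamagawaNumber_eq_one_of_hasGoodReductionAt_holds`), and the places
off `T ∪ {(p)}` contribute `ord_p c_v = 0`. [cite: SilvermanAEC2009, VII.2 (remark after Prop. 2.1) and Cor. VII.6.2] -/
theorem sum_padicValNat_localTamagawaNumber_eq_padicValNat_tamagawaProduct
    (T : Finset (HeightOneSpectrum (𝓞 ℚ)))
    (hpT : (Rat.HeightOneSpectrum.primesEquiv (R := 𝓞 ℚ)).symm ⟨p, hp.out⟩ ∉ T)
    (hT : ∀ v : HeightOneSpectrum (𝓞 ℚ), v ≠ (Rat.HeightOneSpectrum.primesEquiv (R := 𝓞 ℚ)).symm ⟨p, hp.out⟩ →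
      p ∣ (W.baseChange (v.adicCompletion ℚ)).localTamagawaNumber (v.adicCompletionIntegers ℚ) → v ∈ T)
    (h0 : padicValNat p ((W.baseChange (((Rat.HeightOneSpectrum.primesEquiv (R := 𝓞 ℚ)).symm ⟨p, hp.out⟩).adicCompletion ℚ)).localTamagawaNumber
      (((Rat.HeightOneSpectrum.primesEquiv (R := 𝓞 ℚ)).symm ⟨p, hp.out⟩).adicCompletionIntegers ℚ)) = 0) :
    ∑ w ∈ T, padicValNat p ((W.baseChange (w.adicCompletion ℚ)).localTamagawaNumber (w.adicCompletionIntegers ℚ)) =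
      padicValNat p W.tamagawaProduct := by
  set v₀ := (Rat.HeightOneSpectrum.primesEquiv (R := 𝓞 ℚ)).symm ⟨p, hp.out⟩ with hv₀
  obtain ⟨S, hS⟩ := exists_finset_forall_not_mem_good W p
  -- `Tam(W) = c_{v₀} · ∏_{v ∈ R} c_v` for `R = (S ∪ T) ∖ {v₀}`
  set R : Finset (HeightOneSpectrum (𝓞 ℚ)) := (S ∪ T).erase v₀ with hR
  have hv₀R : v₀ ∉ R := fun h ↦ (Finset.mem_erase.mp h).1 rfl
  have hgood : ∀ v ∉ insert v₀ R, W.HasGoodReductionAt v := fun v hv ↦ by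
    refine (hS v fun hvS ↦ hv ?_).2
    by_cases hvv : v = v₀
    · rw [hvv]; exact Finset.mem_insert_self v₀ R
    · exact Finset.mem_insert_of_mem (Finset.mem_erase.mpr ⟨hvv, Finset.mem_union_left T hvS⟩)
  have hTam : W.tamagawaProduct = ∏ v ∈ insert v₀ R,
      (W.baseChange (v.adicCompletion ℚ)).localTamagawaNumber (v.adicCompletionIntegers ℚ) := by
    unfold WeierstrassCurve.tamagawaProduct
    refine finprod_eq_prod_of_mulSupport_subset _ fun v hv ↦ ?_
    rw [Finset.mem_coe]
    by_contra hvS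
    exact hv (W.localTamagawaNumber_eq_one_of_hasGoodReductionAt_holds v (hgood v hvS))
  rw [hTam, padicValNat_finset_prod' p _ _ (fun v _ ↦ localTamagawaNumber_adicCompletion_ne_zero W v),
    Finset.sum_insert hv₀R, h0, zero_add]
  -- `T ⊆ R`, and the places of `R` off `T` contribute `0`
  refine Finset.sum_subset (fun w hw ↦ ?_) fun v hv hvT ↦ ?_
  · exact Finset.mem_erase.mpr ⟨fun h ↦ hpT (by rw [h] at hw; exact hw), Finset.mem_union_right S hw⟩
  · exact padicValNat.eq_zero_of_not_dvd fun hd ↦ hvT (hT v (Finset.mem_erase.mp hv).1 hd)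

omit [W.IsGloballyMinimal] in
/-- `p ∤ #W(ℚ)_tors` when `W(ℚ_p)` has no point of order `p` (tree, gen 30's companion). [cite: SilvermanAEC2009, VII.3 Prop. 3.1] -/
theorem padicValNat_torsionOrder_eq_zero_of_noPTorsion
    (htors : ∀ Q : (W.baseChange ℚ_[p]).toAffine.Point, p • Q = 0 → Q = 0) :
    padicValNat p W.torsionOrder = 0 :=
  padicValNat.eq_zero_of_not_dvd (not_dvd_torsionOrder_of_noPTorsion W p htors)

/-! ## §1 (C3_η) from `hPT` + (R2) + the EXACT reading of Kobayashi Thm. 7.4 at `η` + GZK -/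

/-- **(C3_η) DISCHARGED MODULO PRINT-SHAPED HYPOTHESES.** The cell's typed MISSING INPUT
`QuadraticBranchOddStrictExactControlOfPlusMCAt W p` — "for `W` of analytic rank one, `p ≥ 5`, the good
`a_p = 0` twin `V` with (C1_η), …, `coeff₁ L ≠ 0`: `Sel_str(W/ℚ)[p^∞]` is finite and
`ord_p #Sel_str + n + ord_p(Tam(W)/#W(ℚ)_tors²) = v_p(coeff₁ L)`" — HOLDS given: `hPT` (named fact
`poitouTate_selmerStructure_duality_real ℚ`), `hGZK` (named fact `rank_eq_analyticRank_of_analyticRank_le_one`),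
`hR2` (the cell's typed READING `OddBranchStrictMinusNoFiniteSubmoduleAt W p` of Kitajima–Otsuki 2018
Main Thm. 1.3, sign `−`) and `h74x`, the EXACT reading of Kobayashi 2003 Thm. 7.4 at `η` on the
strict-minus dual datum: (C1_η) at the twin ⟹ `char X^{−,str}(W/ℚ_∞) = (L')` for `L_p⁻(V, η, X) = X·L'`
(hypothesis TEXT in the frame of the cell's (R3), with the ideal EQUALITY the printed equivalence gives;
NOTHING asserted). Proof: GZK ⟹ `Ш(W)` finite; the cyclotomic `ℤ_p`-extension with a normalised
topological generator (tree `CyclotomicZp`) and a dual datum exist; `h74x` ⟹ `char = (L')`,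
`L'(0) = coeff₁ L`; file 122 (x1b GEN 44) ⟹ `#Ш[p^∞]·p^{2n}·∏_{ℓ∈T} p^{ord_p c_ℓ} = p^{ord_p L'(0)}`
with `T` = the bad places `≠ p`; gen 30's index `#Sel_str = p^n·#Ш[p^∞]`; §0: `∑_T ord_p c_ℓ =
ord_p Tam(W)` (`c_p(W) ≤ 4 < p`), `p ∤ #W(ℚ)_tors`. CONDITIONAL on the four displayed hypotheses;
(C1_η) is untouched (it is a hypothesis INSIDE the discharged statement); nothing about (C2_η-GZ) or
`BSD(W, p)` is claimed; nothing booked; the classes served stay OPEN.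
[cite: Kobayashi2003, Thm. 7.4 (p. 13), §4 (p. 8), Thm. 9.3 (p. 26), §2 (p. 4)]
[cite: KitajimaOtsuki2018, Main Thm. 1.3 (arXiv:1607.03612 p. 3)] [cite: GreenbergLNM1716, §4 Thm. 4.1 and Lemma 4.2 (p. 102)]
[cite: MilneADT2006, Ch. I, Thm. 4.10] [cite: Gross1991, Thm. 1.3] [cite: SilvermanAEC2009, Thm. VII.6.1 and Prop. VII.6.3] -/
theorem quadraticBranchOddStrictExactControlOfPlusMCAt_of_readings
    (hPT : poitouTate_selmerStructure_duality_real ℚ)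
    (hGZK : rank_eq_analyticRank_of_analyticRank_le_one)
    (hR2 : OddBranchStrictMinusNoFiniteSubmoduleAt W p)
    (h74x : ∀ (V : WeierstrassCurve ℚ) [V.IsElliptic] [V.IsGloballyMinimal] (C : VariableChange ℚ)
        {N : ℕ} [NeZero N] {f : CuspForm (Gamma0 N) 2},
        p ≠ 2 → C • W.quadraticTwist ((-1) ^ (p / 2) * p) = V →
        V.HasGoodReductionAtPrime p → V.frobeniusTrace p = 0 →
        QuadraticBranchPlusMainConjectureAt V p → IsNewformOf V f →
        ∀ (ϖ : ℚ), (if Even (p / 2) then (ϖ : ℝ) * V.realPeriodRat = plusPeriod f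
            else (ϖ : ℝ) * V.imaginaryPeriodRat = minusPeriod f) →
        ∀ (Lη : IwasawaAlgebra p), IsQuadraticBranchMinusLFunction f p ϖ Lη →
        ∀ (κ : ZpExtension ℚ p) (γ : Field.absoluteGaloisGroup ℚ),
          κ.IsCyclotomic → κ.IsTopGenerator γ → IsCyclotomicVariable p γ →
        ∀ (D : StrictSignedSelmerDualData W κ ℚ_[p] γ (-1)) (L' : IwasawaAlgebra p),
          Lη = PowerSeries.X * L' → D.charIdeal = Ideal.span {L'}) :
    QuadraticBranchOddStrictExactControlOfPlusMCAt W p := by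
  intro V _ _ C N _ f hp5 hCV hgood hap hr h1 hf ϖ hϖ L hL htors P n hP hgen hdiv hndiv hne
  have hp2 : p ≠ 2 := by omega
  set v₀ := (Rat.HeightOneSpectrum.primesEquiv (R := 𝓞 ℚ)).symm ⟨p, hp.out⟩ with hv₀
  -- GZK: `Ш(W)` is finite
  obtain ⟨-, hfin⟩ := hGZK W hr.le
  haveI : Finite W.sha := hfin
  haveI hSha : Finite (AddCommGroup.primaryComponent W.sha p) := inferInstance
  -- the cyclotomic `ℤ_p`-extension of `ℚ` and a normalised topological generator `γ` (`χ_p(γ) = 1 + p`)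
  obtain ⟨γ, hγ, hχ⟩ := CyclotomicZp.exists_isTopGenerator_zpExtension p
  have hκ := CyclotomicZp.isCyclotomic_zpExtension p
  have hγc : IsCyclotomicVariable p γ := ⟨1, IsOfFinOrder.one, by rw [mul_one]; exact hχ⟩
  -- a strict-minus dual datum of `Sel^{−,str}(W/ℚ_∞)` at the model `ℚ_[p]`
  obtain ⟨D⟩ := nonempty_strictSignedSelmerDualData W (CyclotomicZp.zpExtension p) ℚ_[p] (-1) hγ
  -- `L = X·L'`, `L'(0) = coeff₁ L`, and `char X^{−,str} = (L')` by the exact Thm. 7.4 reading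
  obtain ⟨L', hLL', hL'0⟩ := hL.exists_eq_X_mul
  have hchar : D.charIdeal = Ideal.span {L'} :=
    h74x V C hp2 hCV hgood hap h1 hf ϖ hϖ L hL _ γ hκ hγ hγc D L' hLL'
  -- the exceptional set `T`: the places `≠ v₀` off which `W` has good reduction
  obtain ⟨S, hS⟩ := exists_finset_forall_not_mem_good W p
  have hpT : v₀ ∉ S.erase v₀ := fun h ↦ (Finset.mem_erase.mp h).1 rfl
  have hTmem : ∀ v : HeightOneSpectrum (𝓞 ℚ), v ≠ v₀ →
      p ∣ (W.baseChange (v.adicCompletion ℚ)).localTamagawaNumber (v.adicCompletionIntegers ℚ) →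
        v ∈ S.erase v₀ := by
    intro v hv hdvd
    refine Finset.mem_erase.mpr ⟨hv, ?_⟩
    by_contra hvS
    rw [W.localTamagawaNumber_eq_one_of_hasGoodReductionAt_holds v (hS v hvS).2] at hdvd
    exact hp.out.one_lt.ne' (Nat.dvd_one.mp hdvd)
  -- the Selmer side (file 122, with (R2)): `#Ш[p^∞] · (p^{2n} · ∏_T p^{ord_p c_ℓ}) = p^{ord_p L'(0)}`
  have hSel := card_sha_mul_eq_pow_of_oddBranchNoFiniteSubmodule_of_quadraticTwist_signedPrime_rankOne W
    (CyclotomicZp.zpExtension p) hp2 hκ C V hCV hgood hap hPT P hP hgen hdiv hndiv (S.erase v₀) hpT hTmem hγ D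
    hchar hR2
  -- gen 30's index: `#Sel_str(W/ℚ)[p^∞] = p^n · #Ш[p^∞]`
  have hidx := StrictSha.strictSelmerIndexAt_holds W p P n hP hgen htors hdiv hndiv
  -- §0 bookkeeping
  have hv0 := padicValNat_localTamagawaNumber_eq_zero_of_quadraticTwist_signedPrime W p hp5 C V hCV hgood
  have hTamSum := sum_padicValNat_localTamagawaNumber_eq_padicValNat_tamagawaProduct W p (S.erase v₀) hpT
    hTmem hv0
  have htors0 := padicValNat_torsionOrder_eq_zero_of_noPTorsion W p htors
  -- numerics
  have hSha0 : Nat.card (AddCommGroup.primaryComponent W.sha p) ≠ 0 := Nat.card_pos.ne'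
  have hp0 : p ≠ 0 := hp.out.ne_zero
  rw [Finset.prod_pow_eq_pow_sum, ← pow_add, hTamSum] at hSel
  have hval := congrArg (padicValNat p) hSel
  rw [padicValNat.mul hSha0 (pow_ne_zero _ hp0), padicValNat.prime_pow, padicValNat.prime_pow] at hval
  have hidxval : padicValNat p (Nat.card ↥(strictSelmerPInfty W p)) =
      n + padicValNat p (Nat.card (AddCommGroup.primaryComponent W.sha p)) := by
    rw [hidx, padicValNat.mul (pow_ne_zero _ hp0) hSha0, padicValNat.prime_pow]
  refine ⟨Nat.finite_of_card_ne_zero (by rw [hidx]; exact mul_ne_zero (pow_ne_zero _ hp0) hSha0), ?_⟩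
  -- `ord_p(Tam/#tors²) = ord_p Tam`
  have hTamQ : (W.tamagawaProduct : ℚ) ≠ 0 := by exact_mod_cast W.tamagawaProduct_pos_holds.ne'
  have htQ : (W.torsionOrder : ℚ) ≠ 0 := by exact_mod_cast W.torsionOrder_pos_holds.ne'
  have hrat : padicValRat p ((W.tamagawaProduct : ℚ) / (W.torsionOrder : ℚ) ^ 2) =
      (padicValNat p W.tamagawaProduct : ℤ) := by
    rw [padicValRat.div hTamQ (pow_ne_zero 2 htQ), padicValRat.pow, padicValRat.of_nat, padicValRat.of_nat,
      htors0]
    simp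
  -- the valuation of `coeff₁ L = L'(0)` is the natural number `v.toNat`
  have hv' : ((PowerSeries.coeff 1 L : ℤ_[p]) : ℚ_[p]).valuation =
      ((((PowerSeries.constantCoeff L' : ℤ_[p]) : ℚ_[p]).valuation).toNat : ℤ) := by
    rw [← hL'0]
    exact (Int.toNat_of_nonneg (PadicInt.valuation_coe_nonneg)).symm
  rw [hrat, hv', hidxval, ← hval]
  push_cast
  ring

/-! ## §2 Variants: the Kitajima–Otsuki input as its VERBATIM SHAPE; the exact Thm. 7.4 reading from
cc-typer-6's `η`-part object by the dictionary -/

/-- **(C3_η) from `hPT` + the VERBATIM SHAPE `hKO` of Kitajima–Otsuki Main Thm. 1.3 (sign `−`,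
`η`-part; cc-typer-6's text `HKO p`) + the exact Thm. 7.4 reading + GZK** — §1 with (R2) supplied by the
cell's dictionary theorem `SignedTwist.oddBranchStrictMinusNoFiniteSubmoduleAt_of_kitajimaOtsuki13MinusEta`
(P5-5b). Same CONDITIONALITY; nothing asserted about the printed theorems; nothing booked. CITE
NOTE (cell bsd-cm's referee reading REF-6′, wording only): the printed hypothesis (vi) of
Kitajima–Otsuki ("both `Sel^±(F_∞, E[p^∞])^∨` are `Λ`-torsion", all components) is supplied in print,
for `F = ℚ`, by Kobayashi's Thm. 2.2 (p. 5: "`X^±(E/K_∞)` is a finitely generated torsion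
`Λ`-module") = Thm. 7.3 ii) (p. 13: "`Sel^±(E/K_∞)` is `Λ`-cotorsion"), which is therefore
load-bearing for `hKO` beside Main Thm. 1.3; the displayed torsion hypothesis inside `hKO` (the
minus-`η` datum only) is the part a consumer instantiates.
[cite: KitajimaOtsuki2018, Main Thm. 1.3 (= Thm. 4.8) with Def. 2.1 (arXiv:1607.03612 pp. 3, 6)]
[cite: Kobayashi2003, Thm. 2.2 (p. 5) and Thm. 7.3 ii) (p. 13) (the torsion hypothesis (vi), both signs, every η)]
[cite: Kobayashi2003, Thm. 7.4 (p. 13), §4 (p. 8)] -/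
theorem quadraticBranchOddStrictExactControlOfPlusMCAt_of_kitajimaOtsuki
    (hPT : poitouTate_selmerStructure_duality_real ℚ)
    (hGZK : rank_eq_analyticRank_of_analyticRank_le_one)
    (hKO : ∀ (K₀ : Type) [Field K₀] [NumberField K₀] [IsCyclotomicExtension {p} ℚ K₀]
        [(galRange (K := ℚ) K₀).Normal] (ηq : absoluteGaloisGroup ℚ →* ℤˣ),
        (∀ σ ∈ galRange (K := ℚ) K₀, ηq σ = 1) →
      ∀ (V : WeierstrassCurve ℚ) [V.IsElliptic] [V.IsGloballyMinimal],
        p ≠ 2 → V.HasGoodReductionAtPrime p → V.frobeniusTrace p = 0 →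
      ∀ (κ : ZpExtension ℚ p) (γ : absoluteGaloisGroup ℚ),
        κ.IsCyclotomic → κ.IsTopGenerator γ → γ ∈ galRange (K := ℚ) K₀ →
      ∀ (D : EtaSignedSelmerDualData V κ K₀ ℚ_[p] ηq γ (-1)),
        Module.Finite (IwasawaAlgebra p) D.X → Module.IsTorsion (IwasawaAlgebra p) D.X →
        ∀ M : Submodule (IwasawaAlgebra p) D.X, Finite M → M = ⊥)
    (h74x : ∀ (V : WeierstrassCurve ℚ) [V.IsElliptic] [V.IsGloballyMinimal] (C : VariableChange ℚ)
        {N : ℕ} [NeZero N] {f : CuspForm (Gamma0 N) 2},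
        p ≠ 2 → C • W.quadraticTwist ((-1) ^ (p / 2) * p) = V →
        V.HasGoodReductionAtPrime p → V.frobeniusTrace p = 0 →
        QuadraticBranchPlusMainConjectureAt V p → IsNewformOf V f →
        ∀ (ϖ : ℚ), (if Even (p / 2) then (ϖ : ℝ) * V.realPeriodRat = plusPeriod f
            else (ϖ : ℝ) * V.imaginaryPeriodRat = minusPeriod f) →
        ∀ (Lη : IwasawaAlgebra p), IsQuadraticBranchMinusLFunction f p ϖ Lη →
        ∀ (κ : ZpExtension ℚ p) (γ : Field.absoluteGaloisGroup ℚ),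
          κ.IsCyclotomic → κ.IsTopGenerator γ → IsCyclotomicVariable p γ →
        ∀ (D : StrictSignedSelmerDualData W κ ℚ_[p] γ (-1)) (L' : IwasawaAlgebra p),
          Lη = PowerSeries.X * L' → D.charIdeal = Ideal.span {L'}) :
    QuadraticBranchOddStrictExactControlOfPlusMCAt W p :=
  quadraticBranchOddStrictExactControlOfPlusMCAt_of_readings W p hPT hGZK
    (SignedTwist.oddBranchStrictMinusNoFiniteSubmoduleAt_of_kitajimaOtsuki13MinusEta W p hKO) h74x

omit [W.IsElliptic] [W.IsGloballyMinimal] in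
/-- **The exact Thm. 7.4 reading on x1b's object FROM its VERBATIM SHAPE on cc-typer-6's `η`-part object**
(`EtaSignedSelmerDualData V κ ℚ(μ_p) ℚ_[p] η γ (-1)`, the frame of the cell's `h74` with the ideal
EQUALITY as conclusion), by the dictionary: `K₀ = ℚ(μ_p)`, `θ² = p*`, move `γ` to `γ' ∈ Gal(ℚ̄/K₀)` with
`κ γ' = κ γ`, read `D` as `D.toEtaSigned` (SAME module, SAME characteristic ideal). Same proof as the
cell's P5-5b `oddBranchStrictMinusDivisibilityOfPlusMCAt_of_kobayashi74OddEta`. NOTHING about the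
printed theorem is asserted. [cite: Kobayashi2003, Thm. 7.4 (p. 13), §4 p. 8, Thm. 2.2 (p. 5)] -/
theorem exactOddBranchReading_of_kobayashi74OddEtaExact
    (h74X : ∀ (K₀ : Type) [Field K₀] [NumberField K₀] [IsCyclotomicExtension {p} ℚ K₀]
        [(galRange (K := ℚ) K₀).Normal] (ηq : absoluteGaloisGroup ℚ →* ℤˣ),
        (∀ σ ∈ galRange (K := ℚ) K₀, ηq σ = 1) → ηq ≠ 1 →
      ∀ (V : WeierstrassCurve ℚ) [V.IsElliptic] [V.IsGloballyMinimal] {N : ℕ} [NeZero N]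
        {f : CuspForm (Gamma0 N) 2},
        p ≠ 2 → V.HasGoodReductionAtPrime p → V.frobeniusTrace p = 0 →
        QuadraticBranchPlusMainConjectureAt V p → IsNewformOf V f →
      ∀ (ϖ : ℚ), (if Even (p / 2) then (ϖ : ℝ) * V.realPeriodRat = plusPeriod f
          else (ϖ : ℝ) * V.imaginaryPeriodRat = minusPeriod f) →
      ∀ (Lη : IwasawaAlgebra p), IsQuadraticBranchMinusLFunction f p ϖ Lη →
      ∀ (κ : ZpExtension ℚ p) (γ : absoluteGaloisGroup ℚ),
        κ.IsCyclotomic → κ.IsTopGenerator γ → γ ∈ galRange (K := ℚ) K₀ →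
        IsCyclotomicVariable p γ →
      ∀ (D : EtaSignedSelmerDualData V κ K₀ ℚ_[p] ηq γ (-1)) (L' : IwasawaAlgebra p),
        Lη = PowerSeries.X * L' → D.charIdeal = Ideal.span {L'}) :
    ∀ (V : WeierstrassCurve ℚ) [V.IsElliptic] [V.IsGloballyMinimal] (C : VariableChange ℚ)
        {N : ℕ} [NeZero N] {f : CuspForm (Gamma0 N) 2},
        p ≠ 2 → C • W.quadraticTwist ((-1) ^ (p / 2) * p) = V →
        V.HasGoodReductionAtPrime p → V.frobeniusTrace p = 0 →
        QuadraticBranchPlusMainConjectureAt V p → IsNewformOf V f →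
        ∀ (ϖ : ℚ), (if Even (p / 2) then (ϖ : ℝ) * V.realPeriodRat = plusPeriod f
            else (ϖ : ℝ) * V.imaginaryPeriodRat = minusPeriod f) →
        ∀ (Lη : IwasawaAlgebra p), IsQuadraticBranchMinusLFunction f p ϖ Lη →
        ∀ (κ : ZpExtension ℚ p) (γ : Field.absoluteGaloisGroup ℚ),
          κ.IsCyclotomic → κ.IsTopGenerator γ → IsCyclotomicVariable p γ →
        ∀ (D : StrictSignedSelmerDualData W κ ℚ_[p] γ (-1)) (L' : IwasawaAlgebra p),
          Lη = PowerSeries.X * L' → D.charIdeal = Ideal.span {L'} := by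
  intro V _ _ C N _ f hp2 hCV hgood hap h1 hf ϖ hϖ Lη hL κ γ hκ hγ hγc D L' hLL'
  haveI : NeZero p := ⟨(Fact.out : p.Prime).ne_zero⟩
  haveI : IsCyclotomicExtension {p} ℚ (CyclotomicField p ℚ) :=
    CyclotomicField.isCyclotomicExtension p ℚ
  haveI : (galRange (K := ℚ) (CyclotomicField p ℚ)).Normal := normal_galRange_cyclotomic p _
  obtain ⟨θ, ηθ, hθ, hc, hη, hηK, hη1⟩ := SignedTwist.exists_theta_eta_cyclotomicField p hp2
  have hD := SignedTwist.localTowerHyp_padic p κ (CyclotomicField p ℚ) hκ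
  have hκ₀ := kappa_surjOn_galRange_cyclotomic κ (CyclotomicField p ℚ)
  have hcop := coprime_index_galRange_cyclotomic p (CyclotomicField p ℚ)
  obtain ⟨γ', hγ'K, hγ'κ⟩ := hκ₀ (κ γ)
  have hγγ' : γ⁻¹ * γ' ∈ κ.kerSubgroup := by
    rw [ZpExtension.mem_kerSubgroup, map_mul, map_inv, hγ'κ, inv_mul_cancel]
  have hγ' : κ.IsTopGenerator γ' := by rw [ZpExtension.IsTopGenerator, hγ'κ]; exact hγ
  have hγ'c : IsCyclotomicVariable p γ' := SignedTwist.isCyclotomicVariable_of_inv_mul_mem_ker hκ hγγ' hγc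
  have h := h74X (CyclotomicField p ℚ) ηθ hηK hη1 V hp2 hgood hap h1 hf ϖ hϖ Lη hL κ γ' hκ hγ' hγ'K hγ'c
    (D.toEtaSigned W (CyclotomicField p ℚ) hθ hc p κ hCV ηθ hη ℚ_[p] hD hκ₀ hcop hγ'K hγγ') L' hLL'
  rwa [StrictSignedSelmerDualData.toEtaSigned_charIdeal] at h

end Summit.BirchSwinnertonDyer.Rank1Residual.Additive.LevelBridge

end
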